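import Mathlib
import HarnessLib
import Summits.KontsevichZagierPeriods.Zeta5Search.VWPInnerBarnes

/-!
# ζ(5) search — swapping the series of `F_{k+1}` with the Barnes `t`-integral in the corrected induction step (cell `pub-zeta5`, ct-1 g28)

HONEST FRAMING: systematic search; no irrationality claim unless kernel-certified.  An identity of special functions (term-by-term
integration of an absolutely convergent series of Mellin–Barnes integrals); nothing here is an irrationality result, a worthiness
exponent or a denominator statement; no named fact is discharged; no definition is introduced.

Brick B6c (second part) of `HOME/ct-1/g28/VWP-BLUEPRINT-g28.md` §3 (d)–(f): for abstract coefficients `d : ℕ → ℂ` with the summability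
`Σ_μ ‖d_μ‖ (c − t₀ + μ)^{−(c−2t₀)θ} < ∞` (in the application `d_μ` are the terms of `F_{k+1}(h₀; ·, h₃, …)` without the `j = 1` factor and
the hypothesis follows from condition (J)), the weight `Γ(α+s)Γ(β+s)e^{iεπs}` (`α = h₁`, `β = h₂`, `c = 1+h₀` real) integrates the
series `Σ_μ d_μ Γ(μ−s)/Γ(c+μ+s)` term by term:

  **`integral_tsum_inner_eq`**:
  `∫ Γ(α+s)Γ(β+s)e^{iεπs} · (Σ_μ d_μ Γ(μ−s)/Γ(c+μ+s)) dy = 2π · Σ_μ d_μ (−1)^μ Γ(α+μ)Γ(β+μ)Γ(c−α−β)/(Γ(c−β+μ)Γ(c−α+μ))`, `s = −t₀+iy`,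

by `MeasureTheory.integral_tsum_of_summable_integral_norm` with the `μ`-uniform bound `VWPInnerBarnes.exists_integral_norm_inner_le`
and the termwise evaluation `VWPInnerBarnes.inner_barnes_eq`.

Theorems only; imports `Zeta5Search/VWPInnerBarnes`.
-/

noncomputable section

namespace Summit.KontsevichZagierPeriods.Zeta5Search.VWPInnerSwap

open MeasureTheory Set Filter
open scoped Real
open Summit.KontsevichZagierPeriods.Zeta5Search.VWPInnerBarnes

variable {t₀ : ℝ} {α β : ℂ}

/-- **Term-by-term integration of the inner series** (corrected induction step, (d)–(f)): for `0 < t₀ < Re α, Re β`, real `c` with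
`2t₀ ≤ c`, `1 ≤ c − t₀`, `Re α + Re β < c`, `ε = ±1`, `θ ≥ 0` with `Re α + Re β − 2t₀ < (c−2t₀)(1−θ)`, and coefficients `d : ℕ → ℂ` with
`Summable (μ ↦ ‖d μ‖ (c − t₀ + μ)^{−(c−2t₀)θ})`,
`∫ Γ(α+s)Γ(β+s) e^{iεπs} (Σ' μ, d μ · Γ(μ−s)/Γ(c+μ+s)) dy = 2π · Σ' μ, d μ · ((−1)^μ Γ(α+μ)Γ(β+μ)Γ(c−α−β)/(Γ(c−β+μ)Γ(c−α+μ)))`. -/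
theorem integral_tsum_inner_eq (ht₀ : 0 < t₀) (hα : t₀ < α.re) (hβ : t₀ < β.re) {c : ℝ} (hc : 2 * t₀ ≤ c) (hc1 : 1 ≤ c - t₀)
    (hαβ : α.re + β.re < c) {ε : ℝ} (hε : ε = 1 ∨ ε = -1) {θ : ℝ} (hθ0 : 0 ≤ θ)
    (hq : α.re + β.re - 2 * t₀ < (c - 2 * t₀) * (1 - θ)) (d : ℕ → ℂ)
    (hd : Summable fun μ : ℕ => ‖d μ‖ * (c - t₀ + μ) ^ (-((c - 2 * t₀) * θ))) :
    ∫ y : ℝ, Complex.Gamma (α + (-(t₀ : ℂ) + (y : ℂ) * Complex.I)) * Complex.Gamma (β + (-(t₀ : ℂ) + (y : ℂ) * Complex.I)) *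
          Complex.exp (ε * π * Complex.I * (-(t₀ : ℂ) + (y : ℂ) * Complex.I)) *
        ∑' μ : ℕ, d μ * (Complex.Gamma ((μ : ℂ) - (-(t₀ : ℂ) + (y : ℂ) * Complex.I)) /
          Complex.Gamma ((c : ℂ) + μ + (-(t₀ : ℂ) + (y : ℂ) * Complex.I))) =
      2 * π * ∑' μ : ℕ, d μ * ((-1 : ℂ) ^ μ * (Complex.Gamma (α + μ) * Complex.Gamma (β + μ) * Complex.Gamma (c - α - β) /
        (Complex.Gamma (c - β + μ) * Complex.Gamma (c - α + μ)))) := by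
  have hεabs : |ε| ≤ 1 := by rcases hε with h | h <;> simp [h]
  obtain ⟨C, hC, hIn⟩ := exists_integral_norm_inner_le (α := α) (β := β) ht₀ hα hβ hc hc1 hεabs hθ0 hq
  -- the family of termwise integrands
  set F : ℕ → ℝ → ℂ := fun μ y =>
    d μ * (Complex.Gamma (α + (-(t₀ : ℂ) + (y : ℂ) * Complex.I)) * Complex.Gamma (β + (-(t₀ : ℂ) + (y : ℂ) * Complex.I)) *
        Complex.Gamma ((μ : ℂ) - (-(t₀ : ℂ) + (y : ℂ) * Complex.I)) /
        Complex.Gamma ((c : ℂ) + μ + (-(t₀ : ℂ) + (y : ℂ) * Complex.I)) *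
      Complex.exp (ε * π * Complex.I * (-(t₀ : ℂ) + (y : ℂ) * Complex.I))) with hF
  have hFint : ∀ μ, Integrable (F μ) := fun μ => ((hIn μ).1).const_mul (d μ)
  have hFsum : Summable fun μ => ∫ y : ℝ, ‖F μ y‖ := by
    refine Summable.of_nonneg_of_le (fun μ => integral_nonneg fun y => norm_nonneg _) (fun μ => ?_) (hd.mul_left C)
    have h1 : ∫ y : ℝ, ‖F μ y‖ = ‖d μ‖ * ∫ y : ℝ, ‖Complex.Gamma (α + (-(t₀ : ℂ) + (y : ℂ) * Complex.I)) *
        Complex.Gamma (β + (-(t₀ : ℂ) + (y : ℂ) * Complex.I)) * Complex.Gamma ((μ : ℂ) - (-(t₀ : ℂ) + (y : ℂ) * Complex.I)) /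
        Complex.Gamma ((c : ℂ) + μ + (-(t₀ : ℂ) + (y : ℂ) * Complex.I)) *
        Complex.exp (ε * π * Complex.I * (-(t₀ : ℂ) + (y : ℂ) * Complex.I))‖ := by
      rw [← integral_const_mul]
      refine integral_congr_ae (Eventually.of_forall fun y => ?_)
      simp only [hF, norm_mul]
    rw [h1]
    calc ‖d μ‖ * _ ≤ ‖d μ‖ * (C * (c - t₀ + μ) ^ (-((c - 2 * t₀) * θ))) :=
          mul_le_mul_of_nonneg_left (hIn μ).2 (norm_nonneg _)
      _ = C * (‖d μ‖ * (c - t₀ + μ) ^ (-((c - 2 * t₀) * θ))) := by ring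
  -- pointwise: the integrand is `Σ' μ, F μ y`
  have hpt : ∀ y : ℝ,
      Complex.Gamma (α + (-(t₀ : ℂ) + (y : ℂ) * Complex.I)) * Complex.Gamma (β + (-(t₀ : ℂ) + (y : ℂ) * Complex.I)) *
            Complex.exp (ε * π * Complex.I * (-(t₀ : ℂ) + (y : ℂ) * Complex.I)) *
          ∑' μ : ℕ, d μ * (Complex.Gamma ((μ : ℂ) - (-(t₀ : ℂ) + (y : ℂ) * Complex.I)) /
            Complex.Gamma ((c : ℂ) + μ + (-(t₀ : ℂ) + (y : ℂ) * Complex.I))) =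
        ∑' μ : ℕ, F μ y := by
    intro y
    rw [← tsum_mul_left]
    refine tsum_congr fun μ => ?_
    simp only [hF]
    ring
  simp_rw [hpt]
  rw [← integral_tsum_of_summable_integral_norm hFint hFsum, ← tsum_mul_left]
  refine tsum_congr fun μ => ?_
  -- termwise evaluation
  have hev := inner_barnes_eq (α := α) (β := β) ht₀ hα hβ (c := (c : ℂ)) (by simpa using hαβ) hε μ
  have hπ : (π : ℂ) ≠ 0 := by exact_mod_cast Real.pi_pos.ne'
  have h2π : (2 * π : ℂ) ≠ 0 := mul_ne_zero two_ne_zero hπ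
  rw [one_div_mul_eq_div, div_eq_iff h2π] at hev
  have hI : ∫ y : ℝ, F μ y = d μ * (((-1 : ℂ) ^ μ * (Complex.Gamma (α + μ) * Complex.Gamma (β + μ) *
      Complex.Gamma (c - α - β) / (Complex.Gamma (c - β + μ) * Complex.Gamma (c - α + μ)))) * (2 * π)) := by
    simp only [hF]
    rw [integral_const_mul, hev]
  rw [hI]
  ring

end Summit.KontsevichZagierPeriods.Zeta5Search.VWPInnerSwap

end
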